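import Mathlib

/-!
# SoloBlind kernel #217 — the interval Newton certificate in `ℂ` (pair zeros of the A8-CAP closure determinant)

The certified engine (capeng, LEMMA R regime (I)) encloses each band-edge pair zero of `D(z) = det M₄(z)`
by the one-dimensional interval Newton test: on the ball `Z = closedBall z₀ r` the derivative satisfies
`‖D'(z) - c‖ ≤ ρ` with `ρ < ‖c‖` (a derivative ball not containing `0`), and `‖D z₀‖ ≤ (‖c‖ - ρ) r`
(equivalently `N(Z) = z₀ - D(z₀)/B(c,ρ) ⊆ Z`).  Then `D` has exactly one zero in `Z`.
Proof: `g z = z - D z / c` maps `Z` into itself and is a `ρ/‖c‖`-contraction (mean value inequality on the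
convex ball applied to `D z - c z`); Banach's fixed point theorem on the complete set `Z`.
-/

namespace Summit.AnomalousDissipation.AnomalousDissipation.Theorems

open Metric Set NNReal

/-- Mean-value step: `‖(D y - D x) - c (y - x)‖ ≤ ρ ‖y - x‖` on the ball. -/
theorem newton_mv (D D' : ℂ → ℂ) (z₀ c : ℂ) (r ρ : ℝ)
    (hD : ∀ z ∈ closedBall z₀ r, HasDerivAt D (D' z) z)
    (hder : ∀ z ∈ closedBall z₀ r, ‖D' z - c‖ ≤ ρ)
    (x y : ℂ) (hx : x ∈ closedBall z₀ r) (hy : y ∈ closedBall z₀ r) :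
    ‖(D y - D x) - c * (y - x)‖ ≤ ρ * ‖y - x‖ := by
  have hφ : ∀ z ∈ closedBall z₀ r, HasDerivWithinAt (fun w => D w - c * w) (D' z - c) (closedBall z₀ r) z := by
    intro z hz
    have h1 : HasDerivAt (fun w => D w - c * w) (D' z - c * 1) z := (hD z hz).sub ((hasDerivAt_id z).const_mul c)
    rw [mul_one] at h1
    exact h1.hasDerivWithinAt
  have := (convex_closedBall z₀ r).norm_image_sub_le_of_norm_hasDerivWithin_le hφ hder hx hy
  have e : (D y - c * y) - (D x - c * x) = (D y - D x) - c * (y - x) := by ring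
  rw [e] at this
  exact this

/-- **Interval Newton certificate.** Unique zero of `D` in `closedBall z₀ r`. -/
theorem interval_newton_unique_zero (D D' : ℂ → ℂ) (z₀ c : ℂ) (r ρ : ℝ) (hr : 0 ≤ r) (hρ : 0 ≤ ρ)
    (hcρ : ρ < ‖c‖)
    (hD : ∀ z ∈ closedBall z₀ r, HasDerivAt D (D' z) z)
    (hder : ∀ z ∈ closedBall z₀ r, ‖D' z - c‖ ≤ ρ)
    (hN : ‖D z₀‖ ≤ (‖c‖ - ρ) * r) :
    ∃! z, z ∈ closedBall z₀ r ∧ D z = 0 := by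
  have hc0 : c ≠ 0 := by
    intro h; rw [h, norm_zero] at hcρ; linarith
  have hcpos : 0 < ‖c‖ := norm_pos_iff.mpr hc0
  set g : ℂ → ℂ := fun z => z - D z / c with hg
  -- g maps the ball into itself
  have hmaps : MapsTo g (closedBall z₀ r) (closedBall z₀ r) := by
    intro z hz
    rw [mem_closedBall, dist_eq_norm] at hz ⊢
    have hmv := newton_mv D D' z₀ c r ρ hD hder z₀ z (mem_closedBall_self hr) (by rwa [mem_closedBall, dist_eq_norm])
    have e : g z - z₀ = (c * (z - z₀) - (D z - D z₀)) / c - D z₀ / c := by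
      rw [hg]; field_simp; ring
    rw [e]
    calc ‖(c * (z - z₀) - (D z - D z₀)) / c - D z₀ / c‖
        ≤ ‖(c * (z - z₀) - (D z - D z₀)) / c‖ + ‖D z₀ / c‖ := norm_sub_le _ _
      _ = ‖(D z - D z₀) - c * (z - z₀)‖ / ‖c‖ + ‖D z₀‖ / ‖c‖ := by
          rw [norm_div, norm_div, ← norm_neg (c * (z - z₀) - (D z - D z₀)), neg_sub]
      _ ≤ ρ * ‖z - z₀‖ / ‖c‖ + (‖c‖ - ρ) * r / ‖c‖ := by gcongr
      _ ≤ ρ * r / ‖c‖ + (‖c‖ - ρ) * r / ‖c‖ := by gcongr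
      _ = r := by field_simp; ring
  -- g is a contraction on the ball
  obtain ⟨K, hKcoe⟩ : ∃ K : ℝ≥0, (K : ℝ) = ρ / ‖c‖ := ⟨(ρ / ‖c‖).toNNReal, Real.coe_toNNReal _ (by positivity)⟩
  have hKlt : K < 1 := by
    rw [← NNReal.coe_lt_coe, hKcoe, NNReal.coe_one, div_lt_one hcpos]; exact hcρ
  have hlip : LipschitzOnWith K g (closedBall z₀ r) := by
    apply LipschitzOnWith.of_dist_le_mul
    intro x hx y hy
    rw [dist_eq_norm, dist_eq_norm]
    have hmv := newton_mv D D' z₀ c r ρ hD hder y x hy hx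
    have e : g x - g y = (c * (x - y) - (D x - D y)) / c := by rw [hg]; field_simp; ring
    rw [e, norm_div, ← norm_neg (c * (x - y) - (D x - D y)), neg_sub, hKcoe, div_mul_eq_mul_div,
      div_le_div_iff_of_pos_right hcpos]
    exact hmv
  -- Banach on the complete set
  obtain ⟨y, hy, hfix, -⟩ := ContractingWith.exists_fixedPoint' (isClosed_closedBall.isComplete) hmaps
    ⟨hKlt, fun a b => hlip a.2 b.2⟩ (mem_closedBall_self hr) (edist_ne_top _ _)
  have hzero : ∀ z, Function.IsFixedPt g z ↔ D z = 0 := by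
    intro z; rw [Function.IsFixedPt, hg]; constructor
    · intro h; have : D z / c = 0 := by linear_combination -h
      rcases div_eq_zero_iff.mp this with h1 | h1
      · exact h1
      · exact absurd h1 hc0
    · intro h; simp [h]
  refine ⟨y, ⟨hy, (hzero y).mp hfix⟩, ?_⟩
  rintro z ⟨hz, hDz⟩
  have hfz : Function.IsFixedPt g z := (hzero z).mpr hDz
  -- uniqueness from the contraction estimate
  have h1 := hlip.dist_le_mul z hz y hy
  rw [hfz.eq, hfix.eq] at h1
  have hK1 : (K : ℝ) < 1 := by exact_mod_cast hKlt
  have hd : dist z y = 0 := by nlinarith [dist_nonneg (x := z) (y := y)]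
  exact dist_eq_zero.mp hd

end Summit.AnomalousDissipation.AnomalousDissipation.Theorems
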